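import Summits.AnomalousDissipation.AnomalousDissipation.Theorems.GalerkinSteadyZerothLaw.Negative.StokesStates
import Literature.Analysis.FluidPDE.NSGalerkinStationary

/-!
# Vocabulary and kernel-checked composition of the line `idea-sketch-ideator2` (card `euler-core-coat-readout`)
# for the crux `MirrorVariety.GalerkinSteadyZerothLaw` (stmt-AnomalousDissipation-2986)

Definition-FREE support file (the readout identity and the sorry-free, CONDITIONAL composition, all stated over LANDED
vocabulary), so that the line's REGISTERED STUBS — landed one by one as `--supports stmt-AnomalousDissipation-2986` files under `Theorems/` — and
the lead's skeleton (`Cruxes/GalerkinSteadyZerothLaw/Lines/idea-sketch-ideator2.lean`, not importable) speak about the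
SAME declarations.  Everything is at the coefficient level of the route (`galerkinSubspace` / `galerkinRHS` on the
punctured ball `modes (Fin 3) N = (freqBall N).erase 0`), over the landed vocabulary `modes`, `forceCoeff`, `energy`,
`dissipation` (`Theorems/LaminarNeverLoud/Negative/PowerBudget.lean`) and `SteadyState`, `crux_iff`, `fieldOf`,
`steadyState_fieldOf` (`Theorems/GalerkinSteadyZerothLaw/Negative/{LoadBearing,StokesStates}.lean`).  This file adds, in
the parent namespace `….Theorems.GalerkinSteadyZerothLaw` (no new definitions):

* (vocabulary kept in the skeleton only, all transparent: a coefficient vector `C : modes (Fin 3) N → ℂ³` is an exact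
  EULER CORE if real solenoidal, nonzero, with `galerkinRHS S 0 0 C = 0` — ABC flows, cells; a COAT `h` over `C` at clamp
  viscosity `ν` is real solenoidal, `⊥ C` (`∑ Re⟪C k, h k⟫ = 0`), with UNFORCED residual of `C + h` collinear with `C`,
  readout amplitude `s`; the heart `LoudCoatDecades` (card K1 with the triage must-fix `0 < ρ`) = one core shape carries,
  along `νlo j → 0⁺` and frequently in `N`, CONNECTED sets of loud bounded coats whose clamp viscosities cover the decade
  `[νlo j, ρ νlo j]`, `ρ² ε₁ > M` — it appears below spelled out, as the hypothesis `hK1` = the registered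
  `stub_loudCoatDecades` verbatim);
* `readout_eq` (PROVED) — `s · energy C = dissipation ν (C + h)`: the read-off force amplitude is the total dissipation
  over the core energy (pair the residual with `C + h`; `Re⟪ΠB(c,c), c⟫ = 0`);
* `GalerkinSteadyZerothLaw_of` — the composition: the three registered transfer stubs (`stub_coreForce`,
  `stub_decadeIVT`, `stub_coatWitness`, taken as hypotheses VERBATIM) and `LoudCoatDecades` imply the crux BY NAME
  (force `f := fieldOf N₀ C₀`, `ν'_j := νlo j (E_C/ε₁)^{1/2}`, `E := E₁E_C/ε₁`, `ε := E_C^{3/2}/M^{1/2}`; the decade IVT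
  makes the gauged viscosity hit `ν'_j` EXACTLY at each of the frequently many `N`); `line_glue` — the same, curried.

Nothing is asserted unconditionally here except `readout_eq` and bookkeeping lemmas.  References: the crux card
`Cruxes/GalerkinSteadyZerothLaw/Ideas/euler-core-coat-readout.md`; triage `Cruxes/GalerkinSteadyZerothLaw/TRIAGE-r1-2.md`
(`0 < ρ`); Temam, *Navier–Stokes Equations* (1979) Ch. II (1.29) (energy equation of Galerkin steady states);
Robinson–Rodrigo–Sadowski 2016 §4.1 (Fourier–Galerkin system).
-/

noncomputable section

-- `Summit.<Summit>.<Problem>` is the tree's mandated summit-side namespace (CONVENTIONS §2); for this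
-- single-conjunct summit the two coincide, so the duplicate is deliberate.
set_option linter.dupNamespace false

open scoped InnerProductSpace Topology
open MeasureTheory Filter Set UnitAddTorus
open Literature.Analysis.FunctionSpaces Literature.Analysis.FunctionSpaces.Torus
open Literature.Analysis.FluidPDE Literature.Analysis.FluidPDE.Torus

namespace Summit.AnomalousDissipation.AnomalousDissipation.Theorems.GalerkinSteadyZerothLaw

open Summit.AnomalousDissipation.AnomalousDissipation.Theses.MirrorVariety (GalerkinSteadyZerothLaw)
open Summit.AnomalousDissipation.AnomalousDissipation.Theorems.GalerkinSteadyZerothLaw.Negative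
  (SteadyState BandLimited FrequentlyLoud LoudWitness crux_iff fieldOf steadyState_fieldOf integral_norm_sq_fieldOf
    loudness_fieldOf)
open Summit.AnomalousDissipation.AnomalousDissipation.Theorems.LaminarNeverLoud.Negative
  (modes forceCoeff energy dissipation modes_symm zero_not_mem_modes energy_nonneg dissipation_nonpos_of_nonpos
    isRealCoeff_forceCoeff)

/-! ## §1 The readout identity (proved) -/

/-- **Readout identity.** For a coat, the readout amplitude times the core energy is the TOTAL dissipation:
`s · energy C = dissipation ν (C + h)` (pair `-νA c - ΠB(c,c) = -s C` with `c = C + h`, use `Re⟪ΠB(c,c), c⟫ = 0`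
via `sum_re_inner_galerkinRHS_self`, and `rin C h = 0`).  In particular `s > 0` at `ν > 0`. [folklore] -/
theorem readout_eq {N : ℕ} {ν s : ℝ} {C h : ↥(modes (Fin 3) N) → EuclideanSpace ℂ (Fin 3)}
    (hC : C ∈ galerkinSubspace (modes (Fin 3) N)) (hh : h ∈ galerkinSubspace (modes (Fin 3) N))
    (horth : (∑ k, (inner ℂ (C k) (h k)).re) = 0)
    (hs : galerkinRHS (modes (Fin 3) N) ν 0 (C + h) = (-s) • C) :
    s * energy C = dissipation ν (C + h) := by
  have hS : ∀ k ∈ modes (Fin 3) N, -k ∈ modes (Fin 3) N := modes_symm N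
  have hc : C + h ∈ galerkinSubspace (modes (Fin 3) N) := (galerkinSubspace (modes (Fin 3) N)).add_mem hC hh
  have hg : IsRealCoeff (0 : ↥(modes (Fin 3) N) → EuclideanSpace ℂ (Fin 3)) :=
    ((galerkinSubspace (modes (Fin 3) N)).zero_mem).1
  have hid := sum_re_inner_galerkinRHS_self ν hS hg hc
  rw [hs, coeffExt_zero, realTrigPoly_zero, toReal_eGradNormSq_realTrigPoly hS (hc.1.isConjSymm_coeffExt hS),
    sum_coeffExt (fun k v => freqNormSq k * ‖v‖ ^ 2) (C + h)] at hid
  simp only [Pi.zero_apply, inner_zero_left, integral_zero, add_zero] at hid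
  have hL : ∑ k : ↥(modes (Fin 3) N), (inner ℂ ((C + h) k) (((-s) • C) k)).re = -s * energy C := by
    have hterm : ∀ k : ↥(modes (Fin 3) N), (inner ℂ ((C + h) k) (((-s) • C) k)).re =
        -s * (‖C k‖ ^ 2 + (inner ℂ (h k) (C k)).re) := by
      intro k
      have e1 : ((-s) • C) k = Complex.ofReal (-s) • C k := by
        rw [Pi.smul_apply, RCLike.real_smul_eq_coe_smul (K := ℂ)]; rfl
      have e2 : (inner ℂ (C k) (C k)).re = ‖C k‖ ^ 2 := by
        rw [← RCLike.re_to_complex, inner_self_eq_norm_sq]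
      rw [e1, inner_smul_right, Pi.add_apply, inner_add_left]
      simp only [Complex.mul_re, Complex.add_re, Complex.add_im, Complex.ofReal_re, Complex.ofReal_im, zero_mul,
        sub_zero]
      rw [e2]
    rw [Finset.sum_congr rfl fun k _ => hterm k, ← Finset.mul_sum, Finset.sum_add_distrib]
    have hsym : ∑ k : ↥(modes (Fin 3) N), (inner ℂ (h k) (C k)).re = ∑ k, (inner ℂ (C k) (h k)).re := by
      refine Finset.sum_congr rfl fun k _ => ?_
      rw [← inner_conj_symm, Complex.conj_re]
    rw [hsym, horth, add_zero]
    rfl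
  rw [hL] at hid
  unfold dissipation
  linarith

/-! ## §2 Small facts used by the composition -/

/-- A nonzero coefficient vector has positive energy. [folklore] -/
theorem energy_pos {N : ℕ} {C : ↥(modes (Fin 3) N) → EuclideanSpace ℂ (Fin 3)} (hC : C ≠ 0) : 0 < energy C := by
  obtain ⟨k, hk⟩ : ∃ k, C k ≠ 0 := by
    by_contra h
    push Not at h
    exact hC (funext h)
  have hle : ‖C k‖ ^ 2 ≤ energy C :=
    Finset.single_le_sum (f := fun k => ‖C k‖ ^ 2) (fun _ _ => sq_nonneg _) (Finset.mem_univ k)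
  exact lt_of_lt_of_le (by positivity) hle

/-- The total dissipation `(ν, h) ↦ dissipation ν (C + h)` is continuous (a polynomial in finitely many coordinates).
[folklore] -/
theorem continuous_dissipation_coat {N : ℕ} (C : ↥(modes (Fin 3) N) → EuclideanSpace ℂ (Fin 3)) :
    Continuous fun p : ℝ × (↥(modes (Fin 3) N) → EuclideanSpace ℂ (Fin 3)) => dissipation p.1 (C + p.2) := by
  unfold dissipation
  refine continuous_fst.mul (continuous_const.mul ?_)
  refine continuous_finsetSum _ fun k _ => continuous_const.mul ?_
  exact ((continuous_apply k).comp (continuous_const.add continuous_snd)).norm.pow 2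

/-- The energy of the restriction of a family supported in `modes K₀` is the same at every level `N ≥ K₀`. [folklore] -/
theorem energy_restrict_eq {K₀ N : ℕ} {Cfun : (Fin 3 → ℤ) → EuclideanSpace ℂ (Fin 3)}
    (hsupp : ∀ k ∉ modes (Fin 3) K₀, Cfun k = 0) (hKN : K₀ ≤ N) :
    energy (fun k : ↥(modes (Fin 3) N) => Cfun k) = ∑ k ∈ modes (Fin 3) K₀, ‖Cfun k‖ ^ 2 := by
  unfold energy
  rw [Finset.sum_coe_sort (modes (Fin 3) N) (fun k => ‖Cfun k‖ ^ 2)]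
  symm
  refine Finset.sum_subset ?_ ?_
  · intro k hk
    rw [Finset.mem_erase] at hk ⊢
    exact ⟨hk.1, freqBall_mono hKN hk.2⟩
  · intro k _ hk
    rw [hsupp k hk, norm_zero]
    ring

/-- The zero-extension of the restriction `C₀` of a family supported in `modes K₀ ⊆ modes N₀` is the family. [folklore] -/
theorem coeffExt_restrict_eq {K₀ N₀ : ℕ} {Cfun : (Fin 3 → ℤ) → EuclideanSpace ℂ (Fin 3)}
    (hsupp : ∀ k ∉ modes (Fin 3) K₀, Cfun k = 0) (hKN : K₀ ≤ N₀) {C₀ : ↥(modes (Fin 3) N₀) → EuclideanSpace ℂ (Fin 3)}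
    (hC₀ : C₀ = fun k : ↥(modes (Fin 3) N₀) => Cfun k) :
    coeffExt (modes (Fin 3) N₀) C₀ = Cfun := by
  funext k
  by_cases hk : k ∈ modes (Fin 3) N₀
  · rw [coeffExt_of_mem _ hk, hC₀]
  · rw [coeffExt_of_not_mem _ hk, hsupp k]
    intro hk'
    rw [Finset.mem_erase] at hk hk'
    exact hk ⟨hk'.1, freqBall_mono hKN hk'.2⟩

/-! ## §3 Composition: the registered stubs prove the crux BY NAME -/

/-- **Composition of the line `idea-sketch-ideator2` (kernel-checked glue).**  Hypotheses = the three registered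
transfer stubs VERBATIM (`hcore` = `stub_coreForce`: the core's force field and its Fourier vector at every level;
`hIVT` = `stub_decadeIVT`: intermediate value of `ν²ε₁ − ν₀²D` on a connected decade family; `hwit` = `stub_coatWitness`:
readout + gauge + coefficient→field bridge) and the heart `hK1 : LoudCoatDecades`.  Conclusion: the route decl
`MirrorVariety.GalerkinSteadyZerothLaw`.  Force `f := fieldOf N₀ C₀` from a reference level `N₀ ≥ K₀`; `E_C > 0` the core
energy; `ν'_j := νlo j (E_C/ε₁)^{1/2} → 0⁺`, `E := E₁E_C/ε₁`, `ε := E_C^{3/2}/M^{1/2}`; at each `j` and each of the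
frequently many `N ≥ K₀` the IVT coat `(ν, h)` has readout `α² = s = D/E_C` and gauges into a `SteadyState` at viscosity
`ν/α = ν'_j` exactly, energy `≤ E`, loudness `E_C/α ≥ ε`.  (CONDITIONAL: credits the item only when the stubs land.)
[folklore] -/
theorem GalerkinSteadyZerothLaw_of
    (hcore : ∀ (N₀ : ℕ) (C₀ : ↥(modes (Fin 3) N₀) → EuclideanSpace ℂ (Fin 3)),
      C₀ ∈ galerkinSubspace (modes (Fin 3) N₀) →
      IsSmooth (fieldOf N₀ C₀) ∧ IsDivFree (fieldOf N₀ C₀) ∧ HasZeroMean (fieldOf N₀ C₀) ∧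
        ∀ N : ℕ, forceCoeff (modes (Fin 3) N) (fieldOf N₀ C₀) =
          fun k : ↥(modes (Fin 3) N) => coeffExt (modes (Fin 3) N₀) C₀ k)
    (hIVT : ∀ (N : ℕ) (K : Set (ℝ × (↥(modes (Fin 3) N) → EuclideanSpace ℂ (Fin 3))))
      (D : ℝ × (↥(modes (Fin 3) N) → EuclideanSpace ℂ (Fin 3)) → ℝ) (ε₁ M ρ ν₀ : ℝ),
      IsConnected K → ContinuousOn D K → 0 < ε₁ → 0 < ρ → M < ρ ^ 2 * ε₁ → 0 < ν₀ →
      (∀ p ∈ K, ε₁ ≤ D p ∧ D p ≤ M) → Set.Icc ν₀ (ρ * ν₀) ⊆ Prod.fst '' K →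
      ∃ p ∈ K, p.1 ^ 2 * ε₁ = ν₀ ^ 2 * D p)
    (hwit : ∀ (N : ℕ) (C h : ↥(modes (Fin 3) N) → EuclideanSpace ℂ (Fin 3)) (ν α : ℝ)
      (f : UnitAddTorus (Fin 3) → EuclideanSpace ℝ (Fin 3)),
      C ∈ galerkinSubspace (modes (Fin 3) N) → h ∈ galerkinSubspace (modes (Fin 3) N) →
      galerkinRHS (modes (Fin 3) N) ν 0 (C + h) = (-(α ^ 2)) • C → 0 < α →
      MemLp f 2 volume → forceCoeff (modes (Fin 3) N) f = C →
      SteadyState (ν / α) N f (fieldOf N (α⁻¹ • (C + h))) ∧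
        ∫ x, ‖fieldOf N (α⁻¹ • (C + h)) x‖ ^ 2 = energy (C + h) / α ^ 2 ∧
        ν / α * gradNormSq (fieldOf N (α⁻¹ • (C + h))) = dissipation ν (C + h) / α ^ 3)
    (hK1 : ∃ (K₀ : ℕ) (Cfun : (Fin 3 → ℤ) → EuclideanSpace ℂ (Fin 3)), (∀ k ∉ modes (Fin 3) K₀, Cfun k = 0) ∧
      ∃ (E₁ ε₁ M ρ : ℝ) (νlo : ℕ → ℝ), 0 < ε₁ ∧ 0 < ρ ∧ M < ρ ^ 2 * ε₁ ∧ (∀ j, 0 < νlo j) ∧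
        Tendsto νlo atTop (𝓝 0) ∧
        ∀ j, ∃ᶠ N in atTop, ∃ C : ↥(modes (Fin 3) N) → EuclideanSpace ℂ (Fin 3),
          (C = fun k : ↥(modes (Fin 3) N) => Cfun k) ∧
          (C ∈ galerkinSubspace (modes (Fin 3) N) ∧ C ≠ 0 ∧ galerkinRHS (modes (Fin 3) N) 0 0 C = 0) ∧
          ∃ K : Set (ℝ × (↥(modes (Fin 3) N) → EuclideanSpace ℂ (Fin 3))), IsConnected K ∧
            (∀ p ∈ K, (p.2 ∈ galerkinSubspace (modes (Fin 3) N) ∧ (∑ k, (inner ℂ (C k) (p.2 k)).re) = 0 ∧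
                ∃ s : ℝ, galerkinRHS (modes (Fin 3) N) p.1 0 (C + p.2) = (-s) • C) ∧
              energy (C + p.2) ≤ E₁ ∧ ε₁ ≤ dissipation p.1 (C + p.2) ∧ dissipation p.1 (C + p.2) ≤ M) ∧
            Set.Icc (νlo j) (ρ * νlo j) ⊆ Prod.fst '' K) :
    GalerkinSteadyZerothLaw := by
  obtain ⟨K₀, Cfun, hsupp, E₁, ε₁, M, ρ, νlo, hε₁, hρ, hM, hνlo, hlim, hdec⟩ := hK1
  -- a reference level `N₀ ≥ K₀` carrying the core and one coat family (for `ε₁ ≤ M`)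
  obtain ⟨N₀, ⟨C₀, hC₀def, hC₀core, K₀set, hK₀conn, hK₀prop, -⟩, hKN₀⟩ :=
    ((hdec 0).and_eventually (eventually_ge_atTop K₀)).exists
  obtain ⟨p₀, hp₀⟩ := hK₀conn.nonempty
  have hε₁M : ε₁ ≤ M := (hK₀prop p₀ hp₀).2.2.1.trans (hK₀prop p₀ hp₀).2.2.2
  have hMpos : 0 < M := hε₁.trans_le hε₁M
  -- the force field, once and for all
  obtain ⟨hfs, hfd, hfm, hfcoeff⟩ := hcore N₀ C₀ hC₀core.1
  have hext : coeffExt (modes (Fin 3) N₀) C₀ = Cfun := coeffExt_restrict_eq hsupp hKN₀ hC₀def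
  have hfmem : MemLp (fieldOf N₀ C₀) 2 volume :=
    hfs.continuous.memLp_of_hasCompactSupport (HasCompactSupport.of_compactSpace _)
  -- the core energy
  set EC : ℝ := ∑ k ∈ modes (Fin 3) K₀, ‖Cfun k‖ ^ 2 with hECdef
  have hEC0 : energy C₀ = EC := by rw [hC₀def]; exact energy_restrict_eq hsupp hKN₀
  have hEC : 0 < EC := hEC0 ▸ energy_pos hC₀core.2.1
  -- constants of the witness
  refine crux_iff.2 ⟨fieldOf N₀ C₀, hfs, hfd, hfm, fun j => νlo j * Real.sqrt (EC / ε₁), E₁ * (EC / ε₁),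
    EC * Real.sqrt EC / Real.sqrt M, fun j => mul_pos (hνlo j) (Real.sqrt_pos.2 (div_pos hEC hε₁)), ?_,
    by positivity, fun j => ?_⟩
  · simpa using hlim.mul_const (Real.sqrt (EC / ε₁))
  refine ((hdec j).and_eventually (eventually_ge_atTop K₀)).mono ?_
  rintro N ⟨⟨C, hCdef, hCcore, K, hKconn, hKprop, hcov⟩, hKN⟩
  have hCE : energy C = EC := by rw [hCdef]; exact energy_restrict_eq hsupp hKN
  -- the decade sweep
  obtain ⟨p, hpK, hpeq⟩ := hIVT N K (fun q => dissipation q.1 (C + q.2)) ε₁ M ρ (νlo j) hKconn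
    (continuous_dissipation_coat C).continuousOn hε₁ hρ hM (hνlo j)
    (fun q hq => ⟨(hKprop q hq).2.2.1, (hKprop q hq).2.2.2⟩) hcov
  beta_reduce at hpeq
  obtain ⟨⟨hh, horth, s, hs⟩, hEn, hDlo, hDhi⟩ := hKprop p hpK
  -- readout: `s · E_C = D`, `D := dissipation p.1 (C + p.2) ∈ [ε₁, M]`
  have hread : s * EC = dissipation p.1 (C + p.2) := by rw [← hCE]; exact readout_eq hCcore.1 hh horth hs
  have hDpos : 0 < dissipation p.1 (C + p.2) := hε₁.trans_le hDlo
  have hspos : 0 < s := by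
    by_contra hsn
    have : s * EC ≤ 0 := mul_nonpos_of_nonpos_of_nonneg (not_lt.1 hsn) hEC.le
    linarith
  have hsD : s = dissipation p.1 (C + p.2) / EC := by
    field_simp
    linarith
  -- gauge parameter `α = √s`
  set α : ℝ := Real.sqrt s with hαdef
  have hαpos : 0 < α := Real.sqrt_pos.2 hspos
  have hα2 : α ^ 2 = s := Real.sq_sqrt hspos.le
  have hs' : galerkinRHS (modes (Fin 3) N) p.1 0 (C + p.2) = (-(α ^ 2)) • C := by rw [hα2]; exact hs
  -- the force vector at level N is C
  have hfN : forceCoeff (modes (Fin 3) N) (fieldOf N₀ C₀) = C := by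
    rw [hfcoeff N, hext, hCdef]
  obtain ⟨hSS, hEner, hLoud⟩ :=
    hwit N C p.2 p.1 α (fieldOf N₀ C₀) hCcore.1 hh hs' hαpos hfmem hfN
  -- the gauged viscosity is `ν'_j` exactly
  have hp1pos : 0 < p.1 := by
    by_contra hn
    have := dissipation_nonpos_of_nonpos (not_lt.1 hn) (C + p.2)
    linarith
  have hνeq : p.1 / α = νlo j * Real.sqrt (EC / ε₁) := by
    have hl : 0 ≤ p.1 / α := div_nonneg hp1pos.le hαpos.le
    have hr : 0 ≤ νlo j * Real.sqrt (EC / ε₁) := mul_nonneg (hνlo j).le (Real.sqrt_nonneg _)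
    refine (pow_left_inj₀ hl hr two_ne_zero).1 ?_
    rw [div_pow, mul_pow, Real.sq_sqrt (div_pos hEC hε₁).le, hα2, hsD]
    field_simp
    linear_combination hpeq
  rw [hνeq] at hSS hLoud
  refine ⟨fieldOf N (α⁻¹ • (C + p.2)), hSS, ?_, ?_⟩
  · -- energy: `energy (C+h)/α² = energy (C+h) · E_C / D ≤ E₁ · E_C/ε₁`
    rw [hEner, hα2, hsD]
    have hE₁ : 0 ≤ E₁ := (energy_nonneg _).trans hEn
    rw [div_div_eq_mul_div]
    calc energy (C + p.2) * EC / dissipation p.1 (C + p.2)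
        = energy (C + p.2) * (EC / dissipation p.1 (C + p.2)) := by ring
      _ ≤ E₁ * (EC / ε₁) := mul_le_mul hEn (div_le_div_of_nonneg_left hEC.le hε₁ hDlo) (by positivity) hE₁
  · -- loudness: `D/α³ = E_C/α ≥ E_C √E_C/√M` since `α = √(D/E_C) ≤ √M/√E_C`
    rw [hLoud]
    have hα3 : dissipation p.1 (C + p.2) / α ^ 3 = EC / α := by
      have : α ^ 3 = α ^ 2 * α := by ring
      rw [this, hα2, hsD]
      field_simp
    rw [hα3]
    have hαle : α ≤ Real.sqrt M / Real.sqrt EC := by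
      rw [hαdef, hsD, Real.sqrt_div' _ hEC.le]
      exact div_le_div_of_nonneg_right (Real.sqrt_le_sqrt hDhi) (Real.sqrt_nonneg _)
    have hsM : 0 < Real.sqrt M := Real.sqrt_pos.2 hMpos
    have hsE : 0 < Real.sqrt EC := Real.sqrt_pos.2 hEC
    calc EC * Real.sqrt EC / Real.sqrt M = EC / (Real.sqrt M / Real.sqrt EC) := by field_simp
      _ ≤ EC / α := div_le_div_of_nonneg_left hEC.le hαpos hαle


/-- **Line glue, curried form**: the three registered transfer stubs of the line `idea-sketch-ideator2` and its heart
`LoudCoatDecades` imply the crux `MirrorVariety.GalerkinSteadyZerothLaw` (by `GalerkinSteadyZerothLaw_of`). [folklore] -/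
theorem line_glue : (∀ (N₀ : ℕ) (C₀ : ↥(modes (Fin 3) N₀) → EuclideanSpace ℂ (Fin 3)), C₀ ∈ galerkinSubspace (modes (Fin 3) N₀) → IsSmooth (fieldOf N₀ C₀) ∧ IsDivFree (fieldOf N₀ C₀) ∧ HasZeroMean (fieldOf N₀ C₀) ∧ ∀ N : ℕ, forceCoeff (modes (Fin 3) N) (fieldOf N₀ C₀) = fun k : ↥(modes (Fin 3) N) => coeffExt (modes (Fin 3) N₀) C₀ k) → (∀ (N : ℕ) (K : Set (ℝ × (↥(modes (Fin 3) N) → EuclideanSpace ℂ (Fin 3)))) (D : ℝ × (↥(modes (Fin 3) N) → EuclideanSpace ℂ (Fin 3)) → ℝ) (ε₁ M ρ ν₀ : ℝ), IsConnected K → ContinuousOn D K → 0 < ε₁ → 0 < ρ → M < ρ ^ 2 * ε₁ → 0 < ν₀ → (∀ p ∈ K, ε₁ ≤ D p ∧ D p ≤ M) → Set.Icc ν₀ (ρ * ν₀) ⊆ Prod.fst '' K → ∃ p ∈ K, p.1 ^ 2 * ε₁ = ν₀ ^ 2 * D p) → (∀ (N : ℕ) (C h : ↥(modes (Fin 3)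 N) → EuclideanSpace ℂ (Fin 3)) (ν α : ℝ) (f : UnitAddTorus (Fin 3) → EuclideanSpace ℝ (Fin 3)), C ∈ galerkinSubspace (modes (Fin 3) N) → h ∈ galerkinSubspace (modes (Fin 3) N) → galerkinRHS (modes (Fin 3) N) ν 0 (C + h) = (-(α ^ 2)) • C → 0 < α → MemLp f 2 volume → forceCoeff (modes (Fin 3) N) f = C → SteadyState (ν / α) N f (fieldOf N (α⁻¹ • (C + h))) ∧ ∫ x, ‖fieldOf N (α⁻¹ • (C + h)) x‖ ^ 2 = energy (C + h) / α ^ 2 ∧ ν / α * gradNormSq (fieldOf N (α⁻¹ • (C + h))) = dissipation ν (C + h) / α ^ 3) → (∃ (K₀ : ℕ) (Cfun : (Fin 3 → ℤ) → EuclideanSpace ℂ (Fin 3)), (∀ k ∉ modes (Fin 3) K₀, Cfun k = 0) ∧ ∃ (E₁ ε₁ M ρ : ℝ) (νlo : ℕ → ℝ), 0 < ε₁ ∧ 0 < ρ ∧ M < ρ ^ 2 * ε₁ ∧ (∀ j, 0 < νlo j) ∧ Tendsto νlo atTop (𝓝 0) ∧ ∀ j, ∃ᶠ N in atTop, ∃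 C : ↥(modes (Fin 3) N) → EuclideanSpace ℂ (Fin 3), (C = fun k : ↥(modes (Fin 3) N) => Cfun k) ∧ (C ∈ galerkinSubspace (modes (Fin 3) N) ∧ C ≠ 0 ∧ galerkinRHS (modes (Fin 3) N) 0 0 C = 0) ∧ ∃ K : Set (ℝ × (↥(modes (Fin 3) N) → EuclideanSpace ℂ (Fin 3))), IsConnected K ∧ (∀ p ∈ K, (p.2 ∈ galerkinSubspace (modes (Fin 3) N) ∧ (∑ k, (inner ℂ (C k) (p.2 k)).re) = 0 ∧ ∃ s : ℝ, galerkinRHS (modes (Fin 3) N) p.1 0 (C + p.2) = (-s) • C) ∧ energy (C + p.2) ≤ E₁ ∧ ε₁ ≤ dissipation p.1 (C + p.2) ∧ dissipation p.1 (C + p.2) ≤ M) ∧ Set.Icc (νlo j) (ρ * νlo j) ⊆ Prod.fst '' K) → GalerkinSteadyZerothLaw :=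
  fun hcore hIVT hwit hK1 => GalerkinSteadyZerothLaw_of hcore hIVT hwit hK1

end Summit.AnomalousDissipation.AnomalousDissipation.Theorems.GalerkinSteadyZerothLaw

end

-- buildfix 2026-08-20 (ops-buildfix-1 gen 7): enqueue-only re-land — rebuild after B-35 (StokesArc, p233893) healed this module's import closure; no declaration changed.
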